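import Literature.MathematicalPhysics.QuantumFieldTheory.Balaban1983to89.TorusHypercubicSymmetry
import Literature.MathematicalPhysics.QuantumFieldTheory.Balaban1983to89.AveragingRT

/-!
# `Balaban1983to89.B12SmallFieldDomain259` — [Balaban1987RG1]: the small-field domains of p. 259, the
fluctuation-field characteristic function `χ_k` (2.9) p. 266, the critical configuration `V^{(k)}` (2.2)–(2.3)
p. 265, and the Euclidean-invariance clause of the inductive assumptions (p. 263, with (2.17) p. 269), TYPED

HONEST FRAMING (cell `lit-balaban`, verbatim): statement-level skeleton of published theorems with citation tags;
proofs where landed; nothing here is a claim about the Yang–Mills mass gap.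

CITATION HEADER.  T. Bałaban, *Renormalization group approach to lattice gauge field theories. I. Generation of
effective actions in a small field approximation and a coupling constant renormalization in four dimensions*,
Commun. Math. Phys. **109** (1987) 249–301, doi:10.1007/bf01215223 [Balaban1987RG1] (cell paper B12; held text
`paper:balaban1987-cmp109-rg-i-small-field`, journal page = PDF page + 248; displays read from the page renders
`b2b-balaban-ref1/pages/1987-cmp109-rg-I-small-field/…-p011/p015/p017/p018/p021-x2.png`).  Unit `lit-balaban-r09`
(reader/typer of CMP 109), SKELETON rows `B12-p259-sfd`, `B12-2.9`, `B12-2.2–2.3`, `B12-p263-eucl`, `B12-2.17`.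

WHAT IS PRINTED (verbatim).
* p. 259 [PDF 11]: *«To formulate this theorem we introduce small field domains. For the k-th action such a domain
  is determined by the condition |∂U_k(V) − 1| < ε₀η² on T_η, for ε₀ sufficiently small. Another possible definition,
  technically less convenient, is given by the condition |∂V − 1| < ε₀ on T₁⁽ᵏ⁾.»*
* p. 265 [PDF 17]: *«We calculate the integral (2.1) applying the saddle point method. At first we look for critical
  points of the function  V → G(V) + A(U_k(V)), V : V̄ = W. (2.2)  Under the above regularity assumptions there exists
  the exactly one critical point, which is obtained by taking the critical orbit of the function A(U_k(V))
  considered on the subspace, and choosing the element of the orbit satisfying the axial gauge conditions G(V) = 0.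
  This critical configuration, which is a minimum of the function (2.2), is denoted by V⁽ᵏ⁾ = V⁽ᵏ⁾(W), and is
  related to the minimal configuration U_{k+1}(W) in the axial gauge by the equality
  V⁽ᵏ⁾ = Ū^k_{k+1} = M^k(U_{k+1}). (2.3)»*
* p. 266 [PDF 18]: *«Finally we can define the characteristic function χ_k:
  χ_k = Π_{b∈T⁽ᵏ⁾∖{b₀(c): c∈T⁽ᵏ⁺¹⁾}} χ({|B′(b)| < ε₁}). (2.9)
  Another possibility is to take g_k/γ_k ε₁ instead of ε₁, where γ_k = C log(L^kε)⁻¹ with C sufficiently large. It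
  has the advantage that the functions E⁽ʲ⁾, β_j are analytic functions of the effective coupling constants, but it
  has some disadvantages in perturbative calculations also. We have formulated the implications of both
  possibilities in the inductive description. The above restrictions imply also restrictions on B′(b₀(c)), with
  the constant ε₁ replaced by O(ε₁), because these variables can be expressed in terms of the remaining ones as in
  the first step.»*  (v1.0–v1.1 of this header quoted (2.9) as «Π_{b∈T⁽ᵏ⁾}», WITHOUT the excluded set
  `{b₀(c) : c ∈ T⁽ᵏ⁺¹⁾}` — quotation finding D-K16-1 of the pub-balaban β-flow typer 2, 2026-08-21, re-read on the
  600-dpi crop `pub-balaban/b2b-balaban-beta-erice-lit2/g13/cmp109_p266_eq29_x2.png`; corrected in v1.2, see § 5.)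
* p. 267 [PDF 19]: *«[Let us recall that for c ∈ T⁽ᵏ⁺¹⁾ the bond b₀(c) is defined as the bond of the lattice T⁽ᵏ⁾
  contained in c and belonging to the corridor B(c) = {b ∈ T⁽ᵏ⁾ : b₋ ∈ B(c₋), b₊ ∈ B(c₊)}.]»* (print's brackets), with
  p. 252 [PDF 4]: *«B^k(y) = Δ(y) ∩ T^{(k)}_{[L^{−k}δ]}, (0.3)  Δ(y) is a continuous space cube with a center at y and with
  the size δ […] For a bond c and a point x ∈ B(c₋), let [x, x′] denote a contour which is obtained by a parallel
  transport of c to the point x.»* (a bond `c` of `T⁽ᵏ⁺¹⁾` is itself a straight contour of `L` bonds of `T⁽ᵏ⁾`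
  joining the centres `c₋`, `c₊` of two neighbouring cubes).
* p. 263 [PDF 15]: *«Other symmetries are Euclidean lattice transformations. We assume that the action (1.3) is
  invariant with respect to the transformations of the lattice T⁽ᵏ⁾. More precisely, we notice that the explicitly
  defined expressions in the j-th term in (1.3) are invariant with respect to the Euclidean transformations of the
  lattice T⁽ʲ⁺¹⁾, and we assume that this is true for all expressions in this term.»*
* p. 269 [PDF 21]: *«Now consider a Euclidean symmetry r of the torus T, preserving the torus T⁽ᵏ⁺¹⁾. We define
  generally  (rU)(b) = U(rb), rb = r⟨b₋, b₊⟩ = ⟨rb₋, rb₊⟩. (2.17)»*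

WHAT THIS MODULE TYPES, over the cell vocabulary `Setup` (`Background` = the background fields `U_k(V)` of (0.21)/(1.1),
`PlaqSmall`, `Params.eta`, `Averaging.iter` = `M^k`, `ContourData`/`gaugeFixFn` = the gauge-fixing function `G(V)` of
(0.17)/(2.1), `wilsonAction4`, `VecField`, `Flow`) and the lattice symmetries already in the tree (`GaugeField.translate`
of `TorusLimitAxioms`; `GaugeField.permute`, `GaugeField.reflect` of `TorusHypercubicSymmetry`, which realise (2.17)
with the orientation rule (2.18) for reflected bonds):
* `smallFieldDom`, `smallFieldDomAlt` — the two small-field domains of p. 259 (the cell's `B12.RunData.dom` and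
  `Setup.Background.dom` are ABSTRACT sets; these are the printed conditions);
* `chiFluct` = the product `Π_{b∈T⁽ᵏ⁾} χ({|B′(b)| < ε₁})` over ALL bonds (`chiFluct_eq_prod`) — NOT the printed
  (2.9), which EXCLUDES the bonds `b₀(c)`, `c ∈ T⁽ᵏ⁺¹⁾` (located divergence D-K16-1, declared in v1.2): the printed
  `χ_k` is `chiFluctPrinted` of § 5, with `chiFluct = chiFluctPrinted · Π_c χ({|B′(b₀(c))| < ε₁})`
  (`chiFluct_eq_chiFluctPrinted_mul`), `chiFluct ≤ chiFluctPrinted`; the alternative threshold `gammaK`/`chiFluctAlt`;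
* (v1.2, § 5) `b0 c` = the bond `b₀(c)` of p. 267 in this vocabulary (the middle bond `AveragingRT.line c ((L−1)/2)`
  of the straight contour `c`, the unique one in the corridor: `line_mem_corridor_iff`, `b0_injective`, and the
  separation `eq_of_b0_mem_nbhd` used by the linearization of p. 267), `chiFluctPrinted` = (2.9) AS PRINTED;
* `CriticalPoint23` — (2.2)–(2.3) as a `Prop` about a background-field assignment (statement only; the proof is
  [15] = [Balaban1985Variational] Sect. G, not reproduced);
* `EuclInvariant` — invariance of a function of the configurations on `T^{(k)}` under the lattice symmetries
  (translations, coordinate permutations, axis reflections), i.e. the first sentence of the p. 263 clause (the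
  clause the cell's `Step.SFHyp` leaves untyped, DIVERGENCE D-f2.1), and `wilsonAction4_euclInvariant` (the explicitly
  defined term `A(U)` IS invariant — proved from the tree's `wilsonAction_permute/reflect/translate`).
Nothing of the paper is asserted.

v1.1 (docfix, no declaration, statement or proof changed): cross-references to the pre-existing carriers at the loci (2.9),
(2.2)–(2.3), (2.17) (lead SAMELOCUS pre-check); in particular the block-compatible CENTRED reflection `T4Covariance.GaugeField.creflect`.

v1.2 (unit `lit-balaban-r09` gen 10, 2026-08-21; APPEND-ONLY: one new import `AveragingRT`, new § 5, no v1.1 declaration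
changed in name, type or body; the docstring of `chiFluct` and the quotation of (2.9) above corrected) — remedy of the
quotation finding D-K16-1: (2.9) prints the product over `T⁽ᵏ⁾ ∖ {b₀(c) : c ∈ T⁽ᵏ⁺¹⁾}`; § 5 types `b₀(c)` in the cell
vocabulary (`b0`, from the straight-line geometry `AveragingRT.line`/`lineSite` of the centred blocks, standing range
`k + 1 ≤ m + K`), PROVES the defining sentence of p. 267 (`b0_mem_corridor`, `line_mem_corridor_iff`: among the `L`
bonds of the contour `c` exactly the middle one lies in the corridor), `b0_injective`, the separation
`eq_of_b0_mem_nbhd` (no foreign `b₀(c′)`, `c′ ≠ c`, lies inside `B(c₋)`, inside `B(c₊)` or in the corridor of `c` —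
the geometric input the abstract linearization model `B13PkLocalTerms` (`hOp b₀ h`, hypothesis «`b₀ c′ ∉ N c`») leaves
to the geometry), the count `card_compl_range_b0`, and `chiFluctPrinted` = (2.9) AS PRINTED with its product form and
its exact relation to `chiFluct`.  The sentence «restrictions on B′(b₀(c)), with the constant ε₁ replaced by O(ε₁)»
is NOT proved here (it needs the constraint `δ(Q̃(B′))` of (2.10); the operator `h` of p. 267 is `B12HOperator267`).
-/

namespace Literature.MathematicalPhysics.QuantumFieldTheory.Balaban1983to89.B12SmallFieldDomain259

open Literature.MathematicalPhysics.QuantumFieldTheory.Balaban1983to89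

/-! ## 1. The small-field domains of p. 259 -/

section SmallField

variable {P : Params} {G : Type*} [GaugeGroup G]

/-- THE SMALL-FIELD DOMAIN OF THE `k`-TH ACTION (p. 259): the regular `V` on `T^{(k)}` (those in the domain of the
background-field assignment, `bg.dom k`) whose background field satisfies "|∂U_k(V) − 1| < ε₀η² on T_η", `η = L^{−k}`
(`Setup.PlaqSmall (ε₀ η²)` on the finest lattice). [cite: Balaban1987RG1, Thm 1 p.259] -/
def smallFieldDom {av : ∀ j, Averaging P j G} (bg : Background P G av) (ε₀ : ℝ) (k : ℕ) :
    Set (GaugeField P k G) :=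
  {V | V ∈ bg.dom k ∧ PlaqSmall (ε₀ * (P.eta k) ^ 2) (bg.U k V)}

/-- The alternative small-field domain of p. 259, "technically less convenient": "|∂V − 1| < ε₀ on T₁⁽ᵏ⁾". [cite: Balaban1987RG1, Thm 1 p.259] -/
def smallFieldDomAlt (P : Params) (G : Type*) [GaugeGroup G] (ε₀ : ℝ) (k : ℕ) : Set (GaugeField P k G) :=
  {V | PlaqSmall ε₀ V}

/-- Membership in the small-field domain, unfolded. [cite: Balaban1987RG1, Thm 1 p.259] -/
theorem mem_smallFieldDom {av : ∀ j, Averaging P j G} (bg : Background P G av) (ε₀ : ℝ) (k : ℕ)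
    (V : GaugeField P k G) :
    V ∈ smallFieldDom bg ε₀ k ↔ V ∈ bg.dom k ∧ PlaqSmall (ε₀ * (P.eta k) ^ 2) (bg.U k V) := Iff.rfl

/-- The small-field domain is monotone in `ε₀`. [cite: Balaban1987RG1, Thm 1 p.259] -/
theorem smallFieldDom_mono {av : ∀ j, Averaging P j G} (bg : Background P G av) {ε₀ ε₀' : ℝ} (h : ε₀ ≤ ε₀')
    (k : ℕ) : smallFieldDom bg ε₀ k ⊆ smallFieldDom bg ε₀' k := by
  intro V hV
  refine ⟨hV.1, fun p => lt_of_lt_of_le (hV.2 p) ?_⟩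
  exact mul_le_mul_of_nonneg_right h (sq_nonneg _)

end SmallField

/-! ## 2. The characteristic function `χ_k` of (2.9) -/

section Fluct

variable {P : Params} {k : ℕ} {𝔤 : Type*} [Norm 𝔤]

open Classical in
/-- The ALL-BONDS cutoff `Π_{b∈T⁽ᵏ⁾} χ({|B′(b)| < ε₁})`: the characteristic function restricting the fluctuation
field `B′` (a `𝔤`-valued function on the bonds of `T^{(k)}`, `Setup.VecField`) to `|B′(b)| < ε₁` at EVERY bond;
typed as the `{0,1}`-valued density factor (`chiFluct_eq_prod`).  DECLARED DIVERGENCE (D-K16-1, v1.2): the printed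
(2.9) p. 266 is `χ_k = Π_{b∈T⁽ᵏ⁾∖{b₀(c): c∈T⁽ᵏ⁺¹⁾}} χ({|B′(b)| < ε₁})` — it EXCLUDES the bonds `b₀(c)`, whose variables
are eliminated by the constraint `δ(Q̃(B′))` of (2.10) and are only «O(ε₁)»-small (p. 266–267); the printed function
is `chiFluctPrinted` (§ 5), and `chiFluct = chiFluctPrinted · Π_c χ({|B′(b₀(c))| < ε₁}) ≤ chiFluctPrinted`
(`chiFluct_eq_chiFluctPrinted_mul`, `chiFluct_le_chiFluctPrinted`), with equality exactly where all
`|B′(b₀(c))| < ε₁`.  Pre-existing decls at the locus (2.9): the abstract cutoff carrier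
`B16EflSup.FluctuationIntegral.ofSet` (χ = 𝟙_S inside a fluctuation integral) and the tower reading `Beta.HistoryContinuity`
(integrand (2.13) with the cutoff as a datum). [cite: Balaban1987RG1, (2.9) p.266] -/
noncomputable def chiFluct (ε₁ : ℝ) (B : VecField P k 𝔤) : ℝ :=
  if ∀ b : PBond P k, ‖B b‖ < ε₁ then 1 else 0

open Classical in
/-- The PRODUCT form of the all-bonds cutoff: `Π_{b∈T⁽ᵏ⁾} χ({|B′(b)| < ε₁})` (print's (2.9) runs over
`T⁽ᵏ⁾ ∖ {b₀(c)}` instead: `chiFluctPrinted_eq_prod`, § 5). [cite: Balaban1987RG1, (2.9) p.266] -/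
theorem chiFluct_eq_prod (ε₁ : ℝ) (B : VecField P k 𝔤) :
    chiFluct ε₁ B = ∏ b : PBond P k, (if ‖B b‖ < ε₁ then (1 : ℝ) else 0) := by
  unfold chiFluct
  rw [Finset.prod_boole]
  simp

/-- `χ_k ∈ {0, 1}`, in particular `0 ≤ χ_k ≤ 1`. [cite: Balaban1987RG1, (2.9) p.266] -/
theorem chiFluct_nonneg_le_one (ε₁ : ℝ) (B : VecField P k 𝔤) : 0 ≤ chiFluct ε₁ B ∧ chiFluct ε₁ B ≤ 1 := by
  unfold chiFluct
  split_ifs <;> norm_num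

/-- The alternative threshold scale of p. 266: `γ_k = C log(L^kε)⁻¹` ("with C sufficiently large"), `ε = L^{−K}`
(`Setup.Params.eps`).  The consequence print draws from this choice (analyticity of E⁽ʲ⁾, β_j in the couplings) is the
pre-existing hypothesis `B12BetaSmooth.EAnalyticAt`/`BetaAnalyticAt`; `gammaK` is the printed scale itself (`gammaK_eq`).
[cite: Balaban1987RG1, (2.9) p.266] -/
noncomputable def gammaK (C : ℝ) (P : Params) (k : ℕ) : ℝ := C * Real.log (((P.L : ℝ) ^ k * P.eps)⁻¹)

/-- The alternative characteristic function of p. 266: (2.9) with `(g_k/γ_k) ε₁` instead of `ε₁` (the choice under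
which "the functions E⁽ʲ⁾, β_j are analytic functions of the effective coupling constants" — that consequence is the
pre-existing hypothesis `B12BetaSmooth.EAnalyticAt`; cf. `B16EflSup.FluctuationIntegral.ofSet` for the abstract cutoff).
[cite: Balaban1987RG1, (2.9) p.266] -/
noncomputable def chiFluctAlt (C ε₁ : ℝ) (P : Params) (F : Flow) (k : ℕ) (B : VecField P k 𝔤) : ℝ :=
  chiFluct ((F.g k / gammaK C P k) * ε₁) B

/-- `γ_k = C (K − k) log L` for `ε = L^{−K}` and `k ≤ K` (so `γ_k > 0` for `C > 0`, `k < K`, `L > 1`). [cite: Balaban1987RG1, (2.9) p.266] -/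
theorem gammaK_eq (C : ℝ) (P : Params) {k : ℕ} (hk : k ≤ P.K) :
    gammaK C P k = C * (((P.K : ℝ) - k) * Real.log P.L) := by
  unfold gammaK Params.eps
  have hL : (0 : ℝ) < P.L := by exact_mod_cast P.L_pos
  have h1 : ((P.L : ℝ) ^ k * ((P.L : ℝ)⁻¹) ^ P.K)⁻¹ = (P.L : ℝ) ^ (P.K - k) := by
    rw [inv_pow, mul_inv, inv_inv, ← div_eq_inv_mul, pow_sub₀ _ hL.ne' hk]
    rw [div_eq_mul_inv]
  rw [h1, Real.log_pow, Nat.cast_sub hk]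

end Fluct

/-! ## 3. The critical configuration `V^{(k)}` of (2.2)–(2.3) -/

section Critical

variable {P : Params} {G : Type*} [GaugeGroup G]

/-- **(2.2)–(2.3)** p. 265, as a property of a background-field assignment `bg` (`bg.U k V = U_k(V)`), the averaging
`M` and the gauge-fixing function `G(V) = Σ_y Σ_{x∈B(y),x≠y}[1 − Re tr V(y,x)]` (`Setup.gaugeFixFn` of the contour
data at level `k`), at a regular `W` on `T^{(k+1)}`: the configuration `V⁽ᵏ⁾ := M^k(U_{k+1}(W))` (2.3) satisfies
`V̄⁽ᵏ⁾ = W` and the axial gauge conditions `G(V⁽ᵏ⁾) = 0`, and it is THE minimum of `V ↦ G(V) + A(U_k(V))` on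
`{V regular : V̄ = W}` (2.2) ("there exists the exactly one critical point … which is a minimum").  `reg` = the
class of regular `V` print quantifies over ("Under the above regularity assumptions").  Statement only: the proof is
[15] Sect. G.  Pre-existing decls at the locus (2.2)–(2.3): the ABSTRACT nested-minimiser algebra `B10NestedMinimizer`
(`LevelMin.isMinOn_eff_datum`, `eff_min_eq_on_slice`, `penalty_zero_of_isMinOn` — the d = 3 twin B10 (42)–(52) and this
step), of which this Prop is the B12-vocabulary instance (background `bg`, averaging `M`, `gaugeFixFn`).
[cite: Balaban1987RG1, (2.2)–(2.3) p.265] -/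
def CriticalPoint23 (av : ∀ j, Averaging P j G) (bg : Background P G av) (k : ℕ) (cd : ContourData P k G)
    (reg : Set (GaugeField P k G)) (W : GaugeField P (k+1) G) : Prop :=
  let Vk : GaugeField P k G := Averaging.iter av k (bg.U (k+1) W)
  (av k).avg Vk = W ∧ gaugeFixFn cd Finset.univ Vk = 0 ∧ Vk ∈ reg ∧
    ∀ V ∈ reg, (av k).avg V = W →
      gaugeFixFn cd Finset.univ Vk + wilsonAction4 (bg.U k Vk) ≤ gaugeFixFn cd Finset.univ V + wilsonAction4 (bg.U k V) ∧
      (gaugeFixFn cd Finset.univ V + wilsonAction4 (bg.U k V) = gaugeFixFn cd Finset.univ Vk + wilsonAction4 (bg.U k Vk) →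
        V = Vk)

end Critical

/-! ## 4. The Euclidean-invariance clause of the inductive assumptions (p. 263) with (2.17) -/

section Euclid

variable {P : Params} {k : ℕ} {G : Type*} [GaugeGroup G]

/-- EUCLIDEAN INVARIANCE of a function of the configurations on `T^{(k)}` (p. 263: "We assume that the action (1.3)
is invariant with respect to the transformations of the lattice T⁽ᵏ⁾"; the action `(rU)(b) = U(rb)` of (2.17)):
invariance under the lattice translations (`GaugeField.translate`, module `TorusLimitAxioms`) and under the point
group generated by the coordinate permutations and the axis reflections (`GaugeField.permute`, `GaugeField.reflect`,
module `TorusHypercubicSymmetry`, the latter with the orientation rule of (2.18) for reflected bonds).  ONE-LEVEL notion.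
Pre-existing decls at the locus (2.17): the reflections "preserving the torus T^{(k+1)}" across the NESTED tori are the
CENTRED ones, `T4Covariance.GaugeField.creflect` (`emb_creflect`, `iter_creflect`), and `AveragingReflection.not_reflect_equivariant`
proves that the naive `GaugeField.reflect` used here is NOT block-compatible; `Beta.Drift` records the (1.3) reading.  For the
p. 263 clause on the j-th terms (fine lattices) use `creflect`; for a single torus both reflections are symmetries of the
Wilson action (`wilsonAction_euclInvariant`). [cite: Balaban1987RG1, (2.17) p.269] -/
def EuclInvariant (F : GaugeField P k G → ℝ) : Prop :=
  (∀ (a : Site P k) (U : GaugeField P k G), F (GaugeField.translate a U) = F U) ∧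
  (∀ (π : Equiv.Perm (Fin P.d)) (U : GaugeField P k G), F (GaugeField.permute π U) = F U) ∧
  (∀ (μ : Fin P.d) (U : GaugeField P k G), F (GaugeField.reflect μ U) = F U)

/-- The clause of p. 263 for the `k`-th action read as a function `V ↦ A_k(U_k(V))` of the regular `V` on `T^{(k)}`
("The k-th action A_k(V) depends on V through the minimal configuration U_k(V), A_k(V) = A_k(U_k(V))", p. 260). [cite: Balaban1987RG1, §1 p.263] -/
def ActionEuclInvariant {av : ∀ j, Averaging P j G} (bg : Background P G av) (Ak : GaugeField P 0 G → ℝ) (k : ℕ) :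
    Prop :=
  EuclInvariant (fun V : GaugeField P k G => Ak (bg.U k V))

/-- "the explicitly defined expressions … are invariant" (p. 263): the Wilson action `A(U)` (0.2) on `T^{(k)}` IS
Euclidean invariant — from the tree's `wilsonAction_translate` (`TorusLimitAxioms`) and `wilsonAction_permute`,
`wilsonAction_reflect` (`TorusHypercubicSymmetry`). [cite: Balaban1987RG1, §1 p.263] -/
theorem wilsonAction_euclInvariant (w : ℝ) : EuclInvariant (wilsonAction (P := P) (j := k) (G := G) w) :=
  ⟨fun a U => GaugeField.wilsonAction_translate w a U,
   fun π U => GaugeField.wilsonAction_permute w π U,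
   fun μ U => GaugeField.wilsonAction_reflect w μ U⟩

/-- Euclidean-invariant functions form an algebra: sums, products and scalar multiples of invariant functions are
invariant (so the form (1.3) is invariant once each of its terms is). [cite: Balaban1987RG1, §1 p.263] -/
theorem EuclInvariant.add {F₁ F₂ : GaugeField P k G → ℝ} (h₁ : EuclInvariant F₁) (h₂ : EuclInvariant F₂) :
    EuclInvariant (fun U => F₁ U + F₂ U) :=
  ⟨fun a U => by dsimp only; rw [h₁.1 a U, h₂.1 a U],
   fun π U => by dsimp only; rw [h₁.2.1 π U, h₂.2.1 π U],
   fun μ U => by dsimp only; rw [h₁.2.2 μ U, h₂.2.2 μ U]⟩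

/-- Scalar multiples of Euclidean-invariant functions are invariant (e.g. `−(1/g_k²)A`). [cite: Balaban1987RG1, §1 p.263] -/
theorem EuclInvariant.const_mul {F : GaugeField P k G → ℝ} (h : EuclInvariant F) (c : ℝ) :
    EuclInvariant (fun U => c * F U) :=
  ⟨fun a U => by dsimp only; rw [h.1 a U], fun π U => by dsimp only; rw [h.2.1 π U],
   fun μ U => by dsimp only; rw [h.2.2 μ U]⟩

end Euclid

/-! ## 5. (v1.2) The bonds `b₀(c)` of p. 267 and `χ_k` (2.9) AS PRINTED, over `T⁽ᵏ⁾ ∖ {b₀(c) : c ∈ T⁽ᵏ⁺¹⁾}`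

Geometry (standing range `k + 1 ≤ m + K` of `Params`, where the block arithmetic of `TorusGeometry`/`AveragingRT`
holds): the coarse bond `c = ⟨y, y + e_μ⟩` of `T⁽ᵏ⁺¹⁾` is the straight contour `emb y, emb y + e_μ, …, emb y + L e_μ =
emb (y + e_μ)` of `T⁽ᵏ⁾` (`AveragingRT.lineSite c t`, bonds `AveragingRT.line c t`, `t < L`; `lineSite_zero`,
`lineSite_L`); its first `(L−1)/2 + 1` sites lie in `B(c₋)` and the remaining ones in `B(c₊)` (`lineSite_eq_lo/hi`),
so exactly ONE of its bonds has `b₋ ∈ B(c₋)` and `b₊ ∈ B(c₊)`: the middle one, `t = (L−1)/2`.  That bond is `b₀(c)`. -/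

section Printed

variable {P : Params} {k : ℕ}

/-- **`b₀(c)`** (p. 267): «the bond of the lattice T⁽ᵏ⁾ contained in c and belonging to the corridor
B(c) = {b ∈ T⁽ᵏ⁾ : b₋ ∈ B(c₋), b₊ ∈ B(c₊)}» — the middle bond `⟨emb c₋ + ((L−1)/2)e_μ, emb c₋ + ((L+1)/2)e_μ⟩` of the
straight contour `c` (`AveragingRT.line c ((L−1)/2)`); that it is THE bond print describes is `line_mem_corridor_iff`.
[cite: Balaban1987RG1, p.267] -/
def b0 (c : PBond P (k+1)) : PBond P k := AveragingRT.line c ((P.L - 1) / 2)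

/-- `b₀(c)` unfolded. [cite: Balaban1987RG1, p.267] -/
theorem b0_eq_line (c : PBond P (k+1)) : b0 c = AveragingRT.line c ((P.L - 1) / 2) := rfl

/-- `b₀(c)` has the direction of `c`. [cite: Balaban1987RG1, p.267] -/
@[simp] theorem b0_dir (c : PBond P (k+1)) : (b0 c).dir = c.dir := rfl

/-- The initial point of `b₀(c)` is the `((L−1)/2)`-th site of the contour `c`. [cite: Balaban1987RG1, p.267] -/
theorem b0_src (c : PBond P (k+1)) : (b0 c).src = AveragingRT.lineSite c ((P.L - 1) / 2) := rfl

/-- The final point of `b₀(c)` is the `((L−1)/2 + 1)`-th site of the contour `c`. [cite: Balaban1987RG1, p.267] -/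
theorem b0_tgt (c : PBond P (k+1)) : (b0 c).tgt = AveragingRT.lineSite c ((P.L - 1) / 2 + 1) := by
  rw [AveragingRT.lineSite_succ]; rfl

/-- `b₀(c)₋ ∈ B(c₋)` (standing range). [cite: Balaban1987RG1, p.267] -/
theorem blockOf_b0_src (hk : k + 1 ≤ P.m + P.K) (c : PBond P (k+1)) : blockOf (b0 c).src = c.src := by
  rw [b0_src, AveragingRT.lineSite_eq_lo hk c le_rfl, Site.blockOf_blockSite hk]

/-- `b₀(c)₊ ∈ B(c₊)` (standing range). [cite: Balaban1987RG1, p.267] -/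
theorem blockOf_b0_tgt (hk : k + 1 ≤ P.m + P.K) (c : PBond P (k+1)) : blockOf (b0 c).tgt = c.tgt := by
  have hL := P.hL.2
  rw [b0_tgt, AveragingRT.lineSite_eq_hi hk c (t := (P.L - 1) / 2 + 1) (by omega) (by omega),
    Site.blockOf_blockSite hk]

/-- THE CORRIDOR of a coarse bond (p. 267): `B(c) = {b ∈ T⁽ᵏ⁾ : b₋ ∈ B(c₋), b₊ ∈ B(c₊)}` (print writes `B(c)`; the
blocks are `B(c₋)`, `B(c₊)`). [cite: Balaban1987RG1, p.267] -/
def corridor (c : PBond P (k+1)) : Set (PBond P k) :=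
  {b | blockOf b.src = c.src ∧ blockOf b.tgt = c.tgt}

/-- Membership in the corridor, unfolded. [cite: Balaban1987RG1, p.267] -/
theorem mem_corridor_iff (c : PBond P (k+1)) (b : PBond P k) :
    b ∈ corridor c ↔ blockOf b.src = c.src ∧ blockOf b.tgt = c.tgt := Iff.rfl

/-- `b₀(c)` belongs to the corridor of `c` (standing range). [cite: Balaban1987RG1, p.267] -/
theorem b0_mem_corridor (hk : k + 1 ≤ P.m + P.K) (c : PBond P (k+1)) : b0 c ∈ corridor c :=
  ⟨blockOf_b0_src hk c, blockOf_b0_tgt hk c⟩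

/-- A bond has distinct end points: `c₋ ≠ c₊` (every torus `T⁽ʲ⁾` of the cell has at least two sites per direction).
[cite: Balaban1987RG1, (0.1) p.251] -/
theorem src_ne_tgt {j : ℕ} (c : PBond P j) : c.src ≠ c.tgt := by
  intro h
  have h1 := congrFun h c.dir
  simp only [PBond.tgt, Site.shift, Function.update_self] at h1
  have h2 : (1 : ZMod (P.sitesPerDir j)) = 0 := by
    calc (1 : ZMod (P.sitesPerDir j)) = (c.src c.dir + 1) - c.src c.dir := by ring
      _ = 0 := by rw [← h1, sub_self]
  exact one_ne_zero h2

/-- A bond is determined by its two end points. [cite: Balaban1987RG1, (0.1) p.251] -/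
theorem bond_eq_of_src_eq_of_tgt_eq {j : ℕ} {c c' : PBond P j} (h1 : c.src = c'.src) (h2 : c.tgt = c'.tgt) :
    c = c' := by
  have hdir : c.dir = c'.dir := by
    by_contra hne
    have h3 := congrFun h2 c.dir
    simp only [PBond.tgt, Site.shift, Function.update_self, h1, Function.update_of_ne hne] at h3
    have h4 : (1 : ZMod (P.sitesPerDir j)) = 0 := by
      calc (1 : ZMod (P.sitesPerDir j)) = (c'.src c.dir + 1) - c'.src c.dir := by ring
        _ = 0 := by rw [h3, sub_self]
    exact one_ne_zero h4
  cases c; cases c'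
  simp only [PBond.mk.injEq]
  exact ⟨h1, hdir⟩

/-- **«the bond of the lattice T⁽ᵏ⁾ contained in c and belonging to the corridor»** (p. 267) — PROVED: among the `L`
bonds `line c t`, `t < L`, of the straight contour `c`, the ones in the corridor are exactly `t = (L−1)/2`, i.e. `b₀(c)`
is well defined by print's description (standing range). [cite: Balaban1987RG1, p.267] -/
theorem line_mem_corridor_iff (hk : k + 1 ≤ P.m + P.K) (c : PBond P (k+1)) {t : ℕ} (ht : t < P.L) :
    AveragingRT.line c t ∈ corridor c ↔ t = (P.L - 1) / 2 := by
  constructor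
  · rintro ⟨hsrc, htgt⟩
    by_contra hne
    rcases Nat.lt_or_gt_of_ne hne with hlt | hgt
    · -- both end points in `B(c₋)`
      have h1 : blockOf (AveragingRT.line c t).tgt = c.src := by
        change blockOf ((AveragingRT.lineSite c t).shift c.dir) = _
        rw [← AveragingRT.lineSite_succ, AveragingRT.lineSite_eq_lo hk c (by omega), Site.blockOf_blockSite hk]
      exact src_ne_tgt c (h1.symm.trans htgt)
    · -- both end points in `B(c₊)`
      have h1 : blockOf (AveragingRT.line c t).src = c.tgt := by
        change blockOf (AveragingRT.lineSite c t) = _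
        rw [AveragingRT.lineSite_eq_hi hk c hgt ht.le, Site.blockOf_blockSite hk]
      exact src_ne_tgt c (hsrc.symm.trans h1)
  · rintro rfl
    exact b0_mem_corridor hk c

/-- `c ↦ b₀(c)` is injective (standing range): distinct coarse bonds have distinct distinguished fine bonds — the
hypothesis `Function.Injective b₀` of the abstract linearization model `B13PkLocalTerms.hOp_apply_b₀`.
[cite: Balaban1987RG1, p.267] -/
theorem b0_injective (hk : k + 1 ≤ P.m + P.K) : Function.Injective (b0 : PBond P (k+1) → PBond P k) := by
  intro c c' h
  have hdir : c.dir = c'.dir := by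
    have h' : (b0 c).dir = (b0 c').dir := congrArg PBond.dir h
    exact h'
  have hsrc : c.src = c'.src := by rw [← blockOf_b0_src hk c, ← blockOf_b0_src hk c', h]
  cases c; cases c'
  simp only [PBond.mk.injEq]
  exact ⟨hsrc, hdir⟩

/-- THE DEPENDENCE SET `N(c)` of a coarse bond: the fine bonds with both end points in `B(c₋)`, those with both end
points in `B(c₊)`, and the corridor of `c` — the bonds the average `Ū(c)` of (0.4)/(0.12) depends on (contours inside
the two blocks and the parallel transports `[x, x′]` of `c`, p. 252–254). [cite: Balaban1987RG1, (0.12) p.254] -/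
def nbhd (c : PBond P (k+1)) : Set (PBond P k) :=
  {b | (blockOf b.src = c.src ∧ blockOf b.tgt = c.src) ∨ (blockOf b.src = c.tgt ∧ blockOf b.tgt = c.tgt)} ∪
    corridor c

/-- The corridor is part of the dependence set. [cite: Balaban1987RG1, (0.12) p.254] -/
theorem corridor_subset_nbhd (c : PBond P (k+1)) : corridor c ⊆ nbhd c := Set.subset_union_right

/-- `b₀(c) ∈ N(c)`. [cite: Balaban1987RG1, p.267] -/
theorem b0_mem_nbhd (hk : k + 1 ≤ P.m + P.K) (c : PBond P (k+1)) : b0 c ∈ nbhd c :=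
  corridor_subset_nbhd c (b0_mem_corridor hk c)

/-- **SEPARATION of the distinguished bonds** (standing range): no foreign `b₀(c′)`, `c′ ≠ c`, lies in the dependence
set `N(c)` — `b₀(c′)` crosses from `B(c′₋)` to `B(c′₊) ≠ B(c′₋)`, so it is inside no block, and it is in the corridor
of `c` only if `c′₋ = c₋`, `c′₊ = c₊`.  This is the geometric hypothesis «`b₀ c′ ∉ N c` for `c′ ≠ c`» of the abstract
model `B13PkLocalTerms` (there `isLocalIn_fpMap`), on [I]'s centred-block geometry. [cite: Balaban1987RG1, p.267] -/
theorem eq_of_b0_mem_nbhd (hk : k + 1 ≤ P.m + P.K) {c c' : PBond P (k+1)} (h : b0 c' ∈ nbhd c) : c' = c := by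
  have hs := blockOf_b0_src hk c'
  have ht := blockOf_b0_tgt hk c'
  rcases h with (⟨h1, h2⟩ | ⟨h1, h2⟩) | ⟨h1, h2⟩
  · exact absurd ((hs.symm.trans h1).trans (ht.symm.trans h2).symm) (src_ne_tgt c')
  · exact absurd ((hs.symm.trans h1).trans (ht.symm.trans h2).symm) (src_ne_tgt c')
  · exact bond_eq_of_src_eq_of_tgt_eq (hs.symm.trans h1) (ht.symm.trans h2)

/-- `b₀(c′) ∈ N(c) ↔ c′ = c` (standing range). [cite: Balaban1987RG1, p.267] -/
theorem b0_mem_nbhd_iff (hk : k + 1 ≤ P.m + P.K) (c c' : PBond P (k+1)) : b0 c' ∈ nbhd c ↔ c' = c :=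
  ⟨eq_of_b0_mem_nbhd hk, fun h => h ▸ b0_mem_nbhd hk c⟩

open Classical in
/-- The bonds over which the printed product (2.9) runs, `T⁽ᵏ⁾ ∖ {b₀(c) : c ∈ T⁽ᵏ⁺¹⁾}`, number
`|bonds of T⁽ᵏ⁾| − |bonds of T⁽ᵏ⁺¹⁾|` (`= d·N_k^d − d·N_{k+1}^d` by the tree's `T4StabilityFloor.card_pbond`; standing
range; one variable `B′(b₀(c))` per coarse bond is eliminated by the constraint `δ(Q̃(B′))`, p. 267).
[cite: Balaban1987RG1, (2.9) p.266] -/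
theorem card_compl_range_b0 (hk : k + 1 ≤ P.m + P.K) :
    (Finset.univ.filter (fun b : PBond P k => ¬ ∃ c : PBond P (k+1), b0 c = b)).card =
      Fintype.card (PBond P k) - Fintype.card (PBond P (k+1)) := by
  have hset : Finset.univ.filter (fun b : PBond P k => ¬ ∃ c : PBond P (k+1), b0 c = b) =
      Finset.univ \ Finset.univ.image (b0 : PBond P (k+1) → PBond P k) := by
    ext b
    simp only [Finset.mem_filter, Finset.mem_univ, true_and, Finset.mem_sdiff, Finset.mem_image]
  rw [hset, Finset.card_sdiff_of_subset (Finset.subset_univ _), Finset.card_univ,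
    Finset.card_image_of_injective _ (b0_injective hk), Finset.card_univ]

variable {𝔤 : Type*} [Norm 𝔤]

open Classical in
/-- **(2.9) AS PRINTED** p. 266: `χ_k = Π_{b∈T⁽ᵏ⁾∖{b₀(c): c∈T⁽ᵏ⁺¹⁾}} χ({|B′(b)| < ε₁})` — the `{0,1}`-valued cutoff
restricting the fluctuation field to `|B′(b)| < ε₁` at every bond EXCEPT the distinguished bonds `b₀(c)` (whose
variables are eliminated by `δ(Q̃(B′))` in (2.10)).  Relation to the all-bonds cutoff `chiFluct` of § 2:
`chiFluct_eq_chiFluctPrinted_mul`. [cite: Balaban1987RG1, (2.9) p.266] -/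
noncomputable def chiFluctPrinted (ε₁ : ℝ) (B : VecField P k 𝔤) : ℝ :=
  if ∀ b : PBond P k, (¬ ∃ c : PBond P (k+1), b0 c = b) → ‖B b‖ < ε₁ then 1 else 0

open Classical in
/-- The printed PRODUCT form of (2.9): `χ_k = Π_{b ∉ {b₀(c)}} χ({|B′(b)| < ε₁})`. [cite: Balaban1987RG1, (2.9) p.266] -/
theorem chiFluctPrinted_eq_prod (ε₁ : ℝ) (B : VecField P k 𝔤) :
    chiFluctPrinted ε₁ B = ∏ b ∈ Finset.univ.filter (fun b : PBond P k => ¬ ∃ c : PBond P (k+1), b0 c = b),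
      (if ‖B b‖ < ε₁ then (1 : ℝ) else 0) := by
  unfold chiFluctPrinted
  rw [Finset.prod_boole]
  simp only [Finset.mem_filter, Finset.mem_univ, true_and]

/-- `χ_k ∈ {0, 1}`, in particular `0 ≤ χ_k ≤ 1`. [cite: Balaban1987RG1, (2.9) p.266] -/
theorem chiFluctPrinted_nonneg_le_one (ε₁ : ℝ) (B : VecField P k 𝔤) :
    0 ≤ chiFluctPrinted ε₁ B ∧ chiFluctPrinted ε₁ B ≤ 1 := by
  unfold chiFluctPrinted
  split_ifs <;> norm_num

/-- The printed `χ_k` does NOT depend on the variables `B′(b₀(c))`: fields agreeing off the distinguished bonds have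
the same `χ_k`. [cite: Balaban1987RG1, (2.9) p.266] -/
theorem chiFluctPrinted_congr (ε₁ : ℝ) {B B' : VecField P k 𝔤}
    (h : ∀ b : PBond P k, (¬ ∃ c : PBond P (k+1), b0 c = b) → B b = B' b) :
    chiFluctPrinted ε₁ B = chiFluctPrinted ε₁ B' := by
  have hiff : (∀ b : PBond P k, (¬ ∃ c : PBond P (k+1), b0 c = b) → ‖B b‖ < ε₁) ↔
      ∀ b : PBond P k, (¬ ∃ c : PBond P (k+1), b0 c = b) → ‖B' b‖ < ε₁ :=
    forall_congr' fun b => imp_congr_right fun hb => by rw [h b hb]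
  unfold chiFluctPrinted
  by_cases H : ∀ b : PBond P k, (¬ ∃ c : PBond P (k+1), b0 c = b) → ‖B b‖ < ε₁
  · rw [if_pos H, if_pos (hiff.mp H)]
  · rw [if_neg H, if_neg (mt hiff.mpr H)]

open Classical in
/-- **`chiFluct = chiFluctPrinted · Π_c χ({|B′(b₀(c))| < ε₁})`**: the all-bonds cutoff of § 2 is the printed (2.9)
times the cutoff on the eliminated variables. [cite: Balaban1987RG1, (2.9) p.266] -/
theorem chiFluct_eq_chiFluctPrinted_mul (ε₁ : ℝ) (B : VecField P k 𝔤) :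
    chiFluct ε₁ B = chiFluctPrinted ε₁ B * (if ∀ c : PBond P (k+1), ‖B (b0 c)‖ < ε₁ then 1 else 0) := by
  unfold chiFluct chiFluctPrinted
  by_cases H1 : ∀ b : PBond P k, (¬ ∃ c : PBond P (k+1), b0 c = b) → ‖B b‖ < ε₁
  · by_cases H2 : ∀ c : PBond P (k+1), ‖B (b0 c)‖ < ε₁
    · have H : ∀ b : PBond P k, ‖B b‖ < ε₁ := fun b => by
        by_cases hb : ∃ c : PBond P (k+1), b0 c = b
        · obtain ⟨c, rfl⟩ := hb
          exact H2 c
        · exact H1 b hb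
      rw [if_pos H, if_pos H1, if_pos H2, mul_one]
    · have H : ¬ ∀ b : PBond P k, ‖B b‖ < ε₁ := fun h => H2 fun c => h _
      rw [if_neg H, if_pos H1, if_neg H2, mul_zero]
  · have H : ¬ ∀ b : PBond P k, ‖B b‖ < ε₁ := fun h => H1 fun b _ => h b
    rw [if_neg H, if_neg H1, zero_mul]

/-- `chiFluct ≤ chiFluctPrinted`: the all-bonds cutoff is the smaller function. [cite: Balaban1987RG1, (2.9) p.266] -/
theorem chiFluct_le_chiFluctPrinted (ε₁ : ℝ) (B : VecField P k 𝔤) : chiFluct ε₁ B ≤ chiFluctPrinted ε₁ B := by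
  rw [chiFluct_eq_chiFluctPrinted_mul]
  have h := (chiFluctPrinted_nonneg_le_one ε₁ B).1
  split_ifs
  · rw [mul_one]
  · rw [mul_zero]; exact h

/-- Where the eliminated variables are also `< ε₁`, the two cutoffs agree. [cite: Balaban1987RG1, (2.9) p.266] -/
theorem chiFluctPrinted_eq_chiFluct_of (ε₁ : ℝ) (B : VecField P k 𝔤) (h : ∀ c : PBond P (k+1), ‖B (b0 c)‖ < ε₁) :
    chiFluctPrinted ε₁ B = chiFluct ε₁ B := by
  rw [chiFluct_eq_chiFluctPrinted_mul, if_pos h, mul_one]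

/-- The alternative threshold of p. 266 for the PRINTED `χ_k`: (2.9) with `(g_k/γ_k) ε₁` instead of `ε₁`.
[cite: Balaban1987RG1, (2.9) p.266] -/
noncomputable def chiFluctPrintedAlt (C ε₁ : ℝ) (P : Params) (F : Flow) (k : ℕ) (B : VecField P k 𝔤) : ℝ :=
  chiFluctPrinted ((F.g k / gammaK C P k) * ε₁) B

end Printed

end Literature.MathematicalPhysics.QuantumFieldTheory.Balaban1983to89.B12SmallFieldDomain259
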